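import Mathlib
import Summits.CriticalPhenomena.CardyFormulaZ2.Theorems.CardySelfRefinementDefs
import Summits.CriticalPhenomena.CardyFormulaZ2.Theorems.CardySelfRefinementTrivialSectorRateStubFourArmAboveOneTwoArmsLocality
import Summits.CriticalPhenomena.CardyFormulaZ2.Theorems.CardySelfRefinementTrivialSectorRateStubFourArmAboveOneCircuits
import Literature.Probability.Percolation.FourArmGarbanTwoArms
import HarnessLib

/-!
# Stub `stub_sixArmDecay` of line `far-field-is-a-quarter-turn` (crux `TrivialSectorRate`,
stmt-CriticalPhenomena-10266): THE DUAL ONE-ARM DECAY ALONG AN RSW PATH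

Input of the sixth-arm price (S6) of `sixArmDecayAlong_of_fiveArm`
(file `…StubSixArmDecayReduction.lean`): polynomial decay, uniformly along an admissible RSW path
`γ` (`PathOK k γ`, `k = 2, 3`), of the probability under `M_k(γ s)` of a CLOSED DUAL ARM from the
faces indexed in `c + B(m-1)` to a face indexed outside `c + B(n)` — the second conjunct of
Garban's two-arm event `openDualArmsAt c m n` (`FourArmGarbanTwoArms.lean`), kept in that exact
set-builder form:
`{ω | ∃ u w (q : Walk u w), u - c ∈ B(m-1) ∧ w - c ∉ B(n) ∧ ∀ e ∈ q.edges, e ∈ dualConfig ω}`.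

Proof = the mirror image of the two-arm decay (M3) (`openDualArmsAt_decay_along`,
files `…StubFourArmAboveOneTwoArms[Locality].lean`), with OPEN circuits blocking the DUAL arm:

* `not_mem_openCircuitInAnnulusAt_of_dualWalk` — the recentred form of the tree's
  `not_mem_openCircuitInAnnulus_of_dualWalk`: a dual walk from a face indexed in `c + B(a-1)` to a
  face indexed outside `c + B(b)` through dual-open dual edges excludes an open circuit of
  `c + A_{a,b}` around `c`; hence the dual arm across `c + A_{m,n}` misses
  `⋂ᵢ (openCircuitInAnnulusAt c aᵢ bᵢ)ᶜ` for all `m ≤ aᵢ ≤ bᵢ ≤ n`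
  (`real_dualArm_le_real_biInter`);
* `real_biInter_compl_openCircuitInAnnulusAt_eq_prod` — the open-circuit twin of
  `real_biInter_compl_dualCircuitInAnnulusAt_eq_prod`: for `k`-separated annuli the events
  "no open circuit in `c + A_{aᵢ,bᵢ}`" are independent under `M_k(ρ,c₀)` (they are cylinders over
  the pairs of annulus sites, `determinedBy_openCircuitInAnnulusAt_annulus`, whose coin windows are
  pairwise disjoint, `disjoint_coinsOf_of_annulusPairs`; then
  `prodBernoulli_real_inter_biInter_of_determinedBy` on the coin space);
* `real_dualArm_le_pow` — with geometric annuli `aᵢ = 4ⁱ m`, `bᵢ = 2aᵢ` and a uniform open-circuit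
  bound `M_k(openCircuitInAnnulusAt c' a b) ≥ 1 - q` for thin annuli, the dual arm costs `q^J`;
* **`dualArm_decay_along`** (registered helper of the stub) — along `PathOK k γ` the open circuits
  have probability `≥ ρ₄` (`circuitsAlong`, aspect ratio `4`), so the dual arm has probability
  `≤ 2^a (m/n)^a`, `a = log_{1/4} max(1 - ρ₄, 1/4) > 0`, for `m ≥ max a₀ 2`, uniformly in `s`, `c`.

References: H. Kesten, *Percolation theory for mathematicians* (1982), §2; G. Grimmett,
*Percolation* (1999), §11.2, §11.7 (11.78); O. Schramm, S. Smirnov (app. C. Garban), Ann. Probab.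
39 (2011), App. B, (B.6).

Target file:
`Summits/CriticalPhenomena/CardyFormulaZ2/Theorems/CardySelfRefinementTrivialSectorRateStubSixArmDecayDualArm.lean`.
-/

noncomputable section

namespace Summit.CriticalPhenomena.CardyFormulaZ2.Theorems.CardySelfRefinement.FarField

open Set MeasureTheory
open Literature.Probability.LatticeModels Literature.Probability.Percolation
open Literature.Probability.Percolation.QuadCrossing
open Summit.CriticalPhenomena.CardyFormulaZ2.Theses.CardySelfRefinement

/-! ### A dual arm excludes open circuits, around any centre -/

/-- **A closed dual arm across `c + A_{a,b}` excludes an open circuit of `c + A_{a,b}` around `c`**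
(the recentred form of `not_mem_openCircuitInAnnulus_of_dualWalk`, `1 ≤ a ≤ b`): a walk of dual
vertices from a face indexed in `c + B(a-1)` to a face indexed outside `c + B(b)`, all of whose
dual edges cross closed primal edges (`dualConfig ω`), is incompatible with
`openCircuitInAnnulusAt c a b` (translate by `-c`: `relabel_shift_mem_openCircuitInAnnulusAt`,
`map_shift_mem_dualConfig_relabel_iff`). -/
theorem not_mem_openCircuitInAnnulusAt_of_dualWalk {c : Site 2} {a b : ℕ} (ha : 1 ≤ a)
    (hab : a ≤ b) {ω : BondConfig (Site 2)} {u w : Site 2} (q : (zdGraph 2).Walk u w)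
    (hq : ∀ e ∈ q.edges, e ∈ dualConfig ω) (hu : u - c ∈ box 2 (a - 1)) (hw : w - c ∉ box 2 b) :
    ω ∉ openCircuitInAnnulusAt c a b := by
  intro hO
  set ω' : BondConfig (Site 2) := BondConfig.relabel (sym2Equiv (Site.shift (-c))) ω with hω'
  -- the shifted configuration has an open circuit around the origin
  have hO' : ω' ∈ openCircuitInAnnulus a b := by
    have h1 := relabel_shift_mem_openCircuitInAnnulusAt (v := -c) hO
    rwa [add_neg_cancel, openCircuitInAnnulusAt_zero] at h1
  -- the shifted dual walk
  have hshift : ∀ x : Site 2, (zdShiftIso (-c)).toHom x = x - c := fun x => by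
    show x + -c = x - c
    rw [sub_eq_add_neg]
  refine not_mem_openCircuitInAnnulus_of_dualWalk ha hab (q.map (zdShiftIso (-c)).toHom) ?_ ?_ ?_ hO'
  · intro e he
    rw [SimpleGraph.Walk.edges_map, List.mem_map] at he
    obtain ⟨e₀, he₀, rfl⟩ := he
    exact (map_shift_mem_dualConfig_relabel_iff (-c) ω e₀).2 (hq e₀ he₀)
  · rw [hshift]; exact hu
  · rw [hshift]; exact hw

/-! ### Coins of `M_k` read by the open circuit events of separated annuli are disjoint -/

/-- A fine edge `edgeOf vd = {v, v + e_d}` joining two sites of `c + A_{a,b}` has its base vertex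
`v` in `c + A_{a,b}`. -/
theorem fst_sub_mem_annulus_of_edgeOf_mem_pairs {c : Site 2} {a b : ℕ} {vd : Site 2 × Fin 2}
    (h : edgeOf vd ∈ (↑(((annulus 2 (a - 1) b).image (· + c)).sym2) : Set (Sym2 (Site 2)))) :
    vd.1 - c ∈ annulus 2 (a - 1) b := by
  rw [Finset.mem_coe, Finset.mem_sym2_iff] at h
  obtain ⟨y, hy, hyv⟩ := Finset.mem_image.1 (h vd.1 (Sym2.mem_mk_left _ _))
  rw [← (eq_sub_of_add_eq hyv)]
  exact hy

/-- **Coins separate `k`-separated annuli (primal pairs)**: if `edgeOf vd` joins two sites of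
`c + A_{a,b}` and `edgeOf vd'` two sites of `c + A_{a',b'}` with `b + k ≤ a'`, then the two fine
edges read disjoint coin sets (a common coin forces a common coarse base, hence sup-distance `< k`
between the base vertices; compare `disjoint_coinsOf_of_annuli` for the dual pairs). -/
theorem disjoint_coinsOf_of_annulusPairs {k : ℕ} (hk : 0 < k) {c : Site 2} {a b a' b' : ℕ}
    (hba : b + k ≤ a') {vd vd' : Site 2 × Fin 2}
    (h : edgeOf vd ∈ (↑(((annulus 2 (a - 1) b).image (· + c)).sym2) : Set (Sym2 (Site 2))))
    (h' : edgeOf vd' ∈ (↑(((annulus 2 (a' - 1) b').image (· + c)).sym2) : Set (Sym2 (Site 2)))) :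
    Disjoint (coinsOf k vd) (coinsOf k vd') := by
  rw [Set.disjoint_left]
  intro i hi hi'
  obtain ⟨-, htb⟩ := tb_eq_of_mem_coinsOf k hi hi'
  have hv := fst_sub_mem_annulus_of_edgeOf_mem_pairs h
  have hv' := fst_sub_mem_annulus_of_edgeOf_mem_pairs h'
  rw [mem_annulus] at hv hv'
  refine hv'.2 ?_
  have hvb := hv.1
  rw [mem_box] at hvb ⊢
  intro j
  obtain ⟨hlo, hhi⟩ := hvb j
  obtain ⟨hlt1, hlt2⟩ := abs_sub_lt_of_tb_eq hk htb j
  simp only [Pi.sub_apply] at hlo hhi ⊢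
  constructor <;> omega

/-! ### Independence: no open circuit in `J` separated annuli -/

/-- The complement of an event determined by `K` is determined by `K` (local copy). -/
private theorem determinedBy_compl_aux' {ι : Type*} {A : Set (Set ι)} {K : Set ι}
    (h : DeterminedBy A K) : DeterminedBy Aᶜ K := by
  rw [determinedBy_iff] at h ⊢
  intro ω ω' hω
  rw [Set.mem_compl_iff, Set.mem_compl_iff, h ω ω' hω]

/-- **Product formula (open circuits).**  For annuli `c + A_{aᵢ,bᵢ}` (`i ∈ s`) that are
`k`-separated (`bᵢ + k ≤ aⱼ` for `i < j`), the events "no open circuit in the `i`-th annulus" are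
independent under `M_k(ρ,c₀)`:
`M_k(⋂ᵢ (openCircuitInAnnulusAt c aᵢ bᵢ)ᶜ) = ∏ᵢ (1 - M_k(openCircuitInAnnulusAt c aᵢ bᵢ))`
(pull back to the coin product through `cfg k`; the pulled-back events are cylinders over pairwise
disjoint finite coin sets; the open-circuit twin of
`real_biInter_compl_dualCircuitInAnnulusAt_eq_prod`). -/
theorem real_biInter_compl_openCircuitInAnnulusAt_eq_prod {k : ℕ} (hk : 0 < k) (ρ c₀ : ℝ)
    (c : Site 2) (s : Finset ℕ) (a b : ℕ → ℕ)
    (hfar : ∀ i ∈ s, ∀ j ∈ s, i < j → b i + k ≤ a j) :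
    (M k ρ c₀).real (⋂ i ∈ s, (openCircuitInAnnulusAt c (a i) (b i))ᶜ) =
      ∏ i ∈ s, (1 - (M k ρ c₀).real (openCircuitInAnnulusAt c (a i) (b i))) := by
  classical
  set D : ℕ → Set (BondConfig (Site 2)) := fun i => openCircuitInAnnulusAt c (a i) (b i) with hD
  have hDm : ∀ i, MeasurableSet (D i) := fun i => measurableSet_openCircuitInAnnulusAt c (a i) (b i)
  have hIm : MeasurableSet (⋂ i ∈ s, (D i)ᶜ) :=
    Finset.measurableSet_biInter s fun i _ => (hDm i).compl
  -- the finite coin supports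
  set W : ℕ → Set (Sym2 (Site 2)) := fun i =>
    (↑(((annulus 2 (a i - 1) (b i)).image (· + c)).sym2) : Set (Sym2 (Site 2))) with hW
  have hCWfin : ∀ i, (coinWindow k (W i)).Finite := fun i =>
    coinWindow_finite k (Finset.finite_toSet _)
  set S : ℕ → Finset Coin := fun i => (hCWfin i).toFinset with hS
  have hSc : ∀ i, (↑(S i) : Set Coin) = coinWindow k (W i) := fun i => Set.Finite.coe_toFinset _
  -- the pulled-back events are cylinders over the `S i`
  have hC : ∀ i ∈ s, DeterminedBy ((cfg k) ⁻¹' (D i)ᶜ) (↑(S i) : Set Coin) := by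
    intro i _
    rw [hSc]
    exact determinedBy_preimage_cfg k
      (determinedBy_compl_aux' (determinedBy_openCircuitInAnnulusAt_annulus c (a i) (b i)))
  have hCm : ∀ i ∈ s, MeasurableSet ((cfg k) ⁻¹' (D i)ᶜ) := fun i _ =>
    measurable_cfg k (hDm i).compl
  -- the supports are pairwise disjoint
  have hSd : (↑s : Set ℕ).PairwiseDisjoint S := by
    intro i hi j hj hij
    show Disjoint (S i) (S j)
    rw [← Finset.disjoint_coe, hSc, hSc, Set.disjoint_left]
    intro x hx hx'
    obtain ⟨vd, hvd, hxv⟩ := Set.mem_iUnion₂.1 hx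
    obtain ⟨vd', hvd', hxv'⟩ := Set.mem_iUnion₂.1 hx'
    rcases lt_or_gt_of_ne hij with hlt | hlt
    · exact Set.disjoint_left.1 (disjoint_coinsOf_of_annulusPairs hk
        (hfar i (Finset.mem_coe.1 hi) j (Finset.mem_coe.1 hj) hlt) hvd hvd') hxv hxv'
    · exact Set.disjoint_left.1 (disjoint_coinsOf_of_annulusPairs hk
        (hfar j (Finset.mem_coe.1 hj) i (Finset.mem_coe.1 hi) hlt) hvd' hvd) hxv' hxv
  -- pass to the coin space and apply the iterated independence
  rw [map_measureReal_apply (measurable_cfg k) hIm, Set.preimage_iInter₂]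
  have key := prodBernoulli_real_inter_biInter_of_determinedBy (prm k ρ c₀) s S hSd hC hCm
    (determinedBy_univ _) MeasurableSet.univ
  rw [Set.univ_inter, probReal_univ, one_mul] at key
  rw [key]
  refine Finset.prod_congr rfl fun i _ => ?_
  rw [Set.preimage_compl, probReal_compl_eq_one_sub (measurable_cfg k (hDm i)),
    map_measureReal_apply (measurable_cfg k) (hDm i)]

/-! ### The dual arm excludes open circuits in all intermediate annuli -/

/-- **A dual arm crosses every intermediate annulus.**  For radii `1 ≤ aᵢ`, `m ≤ aᵢ ≤ bᵢ ≤ n`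
(`i ∈ s`): the dual arm from a face indexed in `c + B(m-1) ⊆ c + B(aᵢ-1)` to a face indexed
outside `c + B(n) ⊇ c + B(bᵢ)` excludes an open circuit of `c + A_{aᵢ,bᵢ}`
(`not_mem_openCircuitInAnnulusAt_of_dualWalk`), so
`M_k(dual arm across c + A_{m,n}) ≤ M_k(⋂ᵢ (openCircuitInAnnulusAt c aᵢ bᵢ)ᶜ)`. -/
theorem real_dualArm_le_real_biInter (k : ℕ) (ρ c₀ : ℝ) (c : Site 2) (m n : ℕ)
    (s : Finset ℕ) (a b : ℕ → ℕ) (h : ∀ i ∈ s, 1 ≤ a i ∧ m ≤ a i ∧ a i ≤ b i ∧ b i ≤ n) :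
    (M k ρ c₀).real {ω | ∃ (u w : Site 2) (q : (zdGraph 2).Walk u w),
        u - c ∈ box 2 (m - 1) ∧ w - c ∉ box 2 n ∧ ∀ e ∈ q.edges, e ∈ dualConfig ω} ≤
      (M k ρ c₀).real (⋂ i ∈ s, (openCircuitInAnnulusAt c (a i) (b i))ᶜ) := by
  refine measureReal_mono ?_ (measure_ne_top _ _)
  rintro ω ⟨u, w, q, hu, hw, hq⟩
  refine Set.mem_iInter₂.2 fun i hi => ?_
  obtain ⟨h1, h2, h3, h4⟩ := h i hi
  refine not_mem_openCircuitInAnnulusAt_of_dualWalk h1 h3 q hq ?_ ?_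
  · exact box_mono 2 (by omega) hu
  · exact fun hw' => hw (box_mono 2 h4 hw')

/-- **Geometric annuli: the dual arm costs `q^J`.**  If every thin annulus `c' + A_{a,b}` with
`a₀ ≤ a < b`, `2b ≤ 4(b - a)` carries an open circuit around `c'` with `M_k(ρ,c₀)`-probability
`≥ 1 - q`, then for `m ≥ max(a₀, 2)` and `J` annuli `c + A_{4ⁱm, 2·4ⁱm}`, `i < J`, inside radius
`n`, the dual arm across `c + A_{m,n}` has probability at most `q ^ J` (`k ≤ 3 < 2m` makes
consecutive annuli `k`-separated; the mirror image of `real_openDualArmsAt_le_pow`). -/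
theorem real_dualArm_le_pow {k : ℕ} (hk0 : 0 < k) (hk3 : k ≤ 3) (ρ c₀ : ℝ) {q : ℝ}
    {a₀ : ℕ} (hcirc : ∀ (c' : Site 2) (a b : ℕ), a₀ ≤ a → a < b → 2 * b ≤ 4 * (b - a) →
      1 - q ≤ (M k ρ c₀).real (openCircuitInAnnulusAt c' a b))
    (c : Site 2) {m n J : ℕ} (hm0 : a₀ ≤ m) (hm2 : 2 ≤ m)
    (hJ : ∀ i < J, 2 * (4 ^ i * m) ≤ n) :
    (M k ρ c₀).real {ω | ∃ (u w : Site 2) (q : (zdGraph 2).Walk u w),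
        u - c ∈ box 2 (m - 1) ∧ w - c ∉ box 2 n ∧ ∀ e ∈ q.edges, e ∈ dualConfig ω} ≤ q ^ J := by
  haveI := isProbabilityMeasure_M k ρ c₀
  have hpow : ∀ i : ℕ, m ≤ 4 ^ i * m := fun i =>
    Nat.le_mul_of_pos_left m (Nat.one_le_pow _ _ (by norm_num))
  have hgeom : ∀ i ∈ Finset.range J, 1 ≤ 4 ^ i * m ∧ m ≤ 4 ^ i * m ∧ 4 ^ i * m ≤ 2 * (4 ^ i * m) ∧
      2 * (4 ^ i * m) ≤ n := by
    intro i hi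
    have h2 := hpow i
    have h3 := hJ i (Finset.mem_range.1 hi)
    omega
  have hfar : ∀ i ∈ Finset.range J, ∀ j ∈ Finset.range J, i < j →
      2 * (4 ^ i * m) + k ≤ 4 ^ j * m := by
    intro i _ j _ hij
    have h1 : 4 ^ (i + 1) ≤ 4 ^ j := Nat.pow_le_pow_right (by norm_num) hij
    have h2 : 4 ^ (i + 1) * m ≤ 4 ^ j * m := Nat.mul_le_mul_right m h1
    have h3 : 4 ^ (i + 1) * m = 4 * (4 ^ i * m) := by ring
    have h4 := hpow i
    omega
  have hq : ∀ i ∈ Finset.range J,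
      1 - (M k ρ c₀).real (openCircuitInAnnulusAt c (4 ^ i * m) (2 * (4 ^ i * m))) ≤ q := by
    intro i _
    have h4 := hpow i
    have := hcirc c (4 ^ i * m) (2 * (4 ^ i * m)) (by omega) (by omega) (by omega)
    linarith
  calc (M k ρ c₀).real {ω | ∃ (u w : Site 2) (q : (zdGraph 2).Walk u w),
          u - c ∈ box 2 (m - 1) ∧ w - c ∉ box 2 n ∧ ∀ e ∈ q.edges, e ∈ dualConfig ω}
      ≤ (M k ρ c₀).real (⋂ i ∈ Finset.range J,
          (openCircuitInAnnulusAt c (4 ^ i * m) (2 * (4 ^ i * m)))ᶜ) :=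
        real_dualArm_le_real_biInter k ρ c₀ c m n (Finset.range J) (fun i => 4 ^ i * m)
          (fun i => 2 * (4 ^ i * m)) hgeom
    _ = ∏ i ∈ Finset.range J,
          (1 - (M k ρ c₀).real (openCircuitInAnnulusAt c (4 ^ i * m) (2 * (4 ^ i * m)))) :=
        real_biInter_compl_openCircuitInAnnulusAt_eq_prod hk0 ρ c₀ c (Finset.range J)
          (fun i => 4 ^ i * m) (fun i => 2 * (4 ^ i * m)) hfar
    _ ≤ ∏ _i ∈ Finset.range J, q :=
        Finset.prod_le_prod (fun i _ => sub_nonneg.2 measureReal_le_one) hq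
    _ = q ^ J := by rw [Finset.prod_const, Finset.card_range]

/-! ### The registered helper: dual one-arm decay along the path -/

/-- **Dual one-arm decay along an RSW path** (registered helper of the stub `stub_sixArmDecay`;
the one-arm input of the sixth-arm price (S6) of `sixArmDecayAlong_of_fiveArm`).  For `PathOK k γ`,
`k = 2, 3`, there are `c', a > 0` and `m₀` such that for all `s`, every centre `c` and all radii
`m₀ ≤ m ≤ n`, the `M_k(γ s)`-probability of a closed dual arm from a face indexed in `c + B(m-1)`
to a face indexed outside `c + B(n)` (the second conjunct of `openDualArmsAt c m n`) is at most
`c' (m/n)^a`: the dual arm crosses `J ≍ log₄(n/m)` disjoint `k`-separated geometric annuli, in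
each of which (M1) (`circuitsAlong`, aspect ratio `4`) puts an OPEN circuit with probability `≥ ρ₄`
independently of the others (coin product structure of `M_k`), whence the bound
`(1 - ρ₄)^J ≤ 2^a (m/n)^a` with `a = log_{1/4} max(1 - ρ₄, 1/4)` (Kesten 1982 §2; Grimmett 1999
§11.7 (11.78), run for the dependent model `M_k`). -/
theorem dualArm_decay_along {k : ℕ} (hk : k = 2 ∨ k = 3) {γ : unitInterval → ℝ × ℝ}
    (hγ : PathOK k γ) :
    ∃ c' a : ℝ, 0 < c' ∧ 0 < a ∧ ∃ m₀ : ℕ, ∀ (s : unitInterval) (c : Site 2) (m n : ℕ),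
      m₀ ≤ m → m ≤ n →
        (M k (γ s).1 (γ s).2).real {ω | ∃ (u w : Site 2) (q : (zdGraph 2).Walk u w),
          u - c ∈ box 2 (m - 1) ∧ w - c ∉ box 2 n ∧ ∀ e ∈ q.edges, e ∈ dualConfig ω} ≤
          c' * ((m : ℝ) / n) ^ a := by
  have hk0 : 0 < k := by rcases hk with rfl | rfl <;> norm_num
  have hk3 : k ≤ 3 := by rcases hk with rfl | rfl <;> norm_num
  obtain ⟨ρs, hρs, a₀, hcirc⟩ := circuitsAlong hk hγ (K := 4) (by norm_num)
  -- the decay rate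
  set q : ℝ := max (1 - ρs) (1 / 4) with hq
  have hq0 : 0 < q := lt_of_lt_of_le (by norm_num) (le_max_right _ _)
  have hq1 : q < 1 := max_lt (by linarith) (by norm_num)
  have h14 : (0 : ℝ) ≤ 1 / 4 := by norm_num
  set α : ℝ := Real.logb (1 / 4) q with hα
  have hα0 : 0 < α := Real.logb_pos_of_base_lt_one (by norm_num) (by norm_num) hq0 hq1
  have hqα : (1 / 4 : ℝ) ^ α = q := Real.rpow_logb (by norm_num) (by norm_num) hq0
  refine ⟨(2 : ℝ) ^ α, α, by positivity, hα0, max a₀ 2, fun s c m n hm hmn => ?_⟩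
  have hm0 : a₀ ≤ m := (le_max_left _ _).trans hm
  have hm2 : 2 ≤ m := (le_max_right _ _).trans hm
  -- the number `J` of geometric annuli between `m` and `n`
  obtain ⟨J, hJ1, hJ2⟩ : ∃ J : ℕ, (∀ i < J, 2 * (4 ^ i * m) ≤ n) ∧ n < 2 * (4 ^ J * m) := by
    refine ⟨Nat.clog 4 (n / (2 * m) + 1), fun i hi => ?_, ?_⟩
    · have h4 : 4 ^ i < n / (2 * m) + 1 := (Nat.lt_clog_iff_pow_lt (by norm_num)).1 hi
      have h5 : 4 ^ i * (2 * m) ≤ n / (2 * m) * (2 * m) :=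
        Nat.mul_le_mul_right (2 * m) (Nat.lt_succ_iff.1 h4)
      have h6 : n / (2 * m) * (2 * m) ≤ n := Nat.div_mul_le_self _ _
      have e1 : 4 ^ i * (2 * m) = 2 * (4 ^ i * m) := by ring
      omega
    · have h4 : n / (2 * m) + 1 ≤ 4 ^ Nat.clog 4 (n / (2 * m) + 1) :=
        Nat.le_pow_clog (by norm_num) _
      have h5 : n < n / (2 * m) * (2 * m) + 2 * m := Nat.lt_div_mul_add (by omega)
      have h6 : (n / (2 * m) + 1) * (2 * m) ≤
          4 ^ Nat.clog 4 (n / (2 * m) + 1) * (2 * m) := Nat.mul_le_mul_right (2 * m) h4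
      have e2 : (n / (2 * m) + 1) * (2 * m) = n / (2 * m) * (2 * m) + 2 * m := by
        ring
      have e3 : 4 ^ Nat.clog 4 (n / (2 * m) + 1) * (2 * m) =
          2 * (4 ^ Nat.clog 4 (n / (2 * m) + 1) * m) := by ring
      omega
  -- the probability bound `q ^ J`
  have hP : (M k (γ s).1 (γ s).2).real {ω | ∃ (u w : Site 2) (q : (zdGraph 2).Walk u w),
      u - c ∈ box 2 (m - 1) ∧ w - c ∉ box 2 n ∧ ∀ e ∈ q.edges, e ∈ dualConfig ω} ≤ q ^ J :=
    real_dualArm_le_pow hk0 hk3 (γ s).1 (γ s).2 (q := q) (a₀ := a₀)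
      (fun c' a b h1 h2 h3 => by
        have := (hcirc s c' a b h1 h2 h3).1
        linarith [le_max_left (1 - ρs) (1 / 4 : ℝ)])
      c hm0 hm2 hJ1
  -- arithmetic: `q ^ J = ((1/4)^J)^α ≤ (2 m / n)^α`
  have hn0 : (0 : ℝ) < n := by exact_mod_cast (show 0 < n by omega)
  have h4J : (0 : ℝ) < (4 : ℝ) ^ J := by positivity
  have hratio : ((1 : ℝ) / 4) ^ J ≤ 2 * ((m : ℝ) / n) := by
    rw [one_div_pow, div_le_iff₀ h4J,
      show 2 * ((m : ℝ) / n) * 4 ^ J = 2 * (4 ^ J * m) / n by ring, le_div_iff₀ hn0, one_mul]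
    exact_mod_cast hJ2.le
  calc (M k (γ s).1 (γ s).2).real {ω | ∃ (u w : Site 2) (q : (zdGraph 2).Walk u w),
          u - c ∈ box 2 (m - 1) ∧ w - c ∉ box 2 n ∧ ∀ e ∈ q.edges, e ∈ dualConfig ω}
        ≤ q ^ J := hP
    _ = (((1 : ℝ) / 4) ^ J) ^ α := by rw [← hqα, Real.rpow_pow_comm h14]
    _ ≤ (2 * ((m : ℝ) / n)) ^ α := Real.rpow_le_rpow (by positivity) hratio hα0.le
    _ = (2 : ℝ) ^ α * ((m : ℝ) / n) ^ α := Real.mul_rpow (by norm_num) (by positivity)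

end Summit.CriticalPhenomena.CardyFormulaZ2.Theorems.CardySelfRefinement.FarField

end
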